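import Literature.MathematicalPhysics.KineticTheory.LangevinChainGibbs
import Literature.MathematicalPhysics.KineticTheory.InfiniteChainSeveredGibbs
import Literature.MathematicalPhysics.KineticTheory.InfiniteChainGibbsUniqueness

/-!
# The free finite-volume Gibbs state of the chain is DLR in the bulk (engine of stub (E1))

Helper (`--supports stmt-AtomisticToContinuum-14013`) for the line `series-law-at-every-laplace-frequency`
(SketchIdeator2) of the crux `LatticeLandauDamping.AbelThermodynamicLimit`, stub (E1) `stub_bulkWindowEquivalence`
(anchor-uniform bulk equivalence of ensembles). Registered sub-goal `pinnedChain_windowEventDLREstimate`.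

Content (folklore; Georgii 2011 Thm 10.25/§11.1, Friedli–Velenik 2017 Lemma 6.15, for the nearest-neighbour
oscillator chain):

* `BulkWindow.hamiltonian_eq_sum_embed` — the free-ends Hamiltonian `P.hamiltonian N` of `FouriersLaw.lean`, read
  through the embedding `OscillatorChain.embed {s,…,s+N-1} e η₀ : PhaseSpace N → (ℤ → ℝ × ℝ)` along `k ↦ s + k`, is
  the sum of the one-site energies over `{s,…,s+N-1}` and of the bond energies over the INTERIOR bonds `{s,…,s+N-2}`;
* `BulkWindow.gibbsMeasure_preimage_embed_eq_lintegral_chainSpecification` — **the free finite-volume Gibbs state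
  `gibbsMeasure N T = Z⁻¹ e^{-H_N/T} dq dp` (`LangevinChainGibbs.lean`) satisfies the DLR equation
  `μ_N(ι⁻¹A) = ∫ γ_Λ(A | ι z) dμ_N(z)` for the infinite-chain specification `chainSpecification P T` and every finite
  `Λ` whose bonds are interior bonds of the chain** (general `P` with measurable `U`, `V ≥ 0`, `T > 0`,
  `e^{-U/T} ∈ L¹`): Lebesgue measure on `PhaseSpace N` is the glued product measure of the kernel
  (`map_glueWith_eq_map_embed`), the free Boltzmann weight factorises as `e^{-H_Λ/T} · R` with `R` not reading `Λ`,
  and the fibre identity `lmarginal_mul_mul_eq_of_dependsOn` applies;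
* `pinnedChain_windowEventDLREstimate` (registered) — for the pinned anharmonic chain: if the window kernel
  `γ_{\{-M,…,m+M\}}(A | η)` is `ε`-close to `L ∈ [0,1]` whenever `|q_{-M-1}|, |q_{m+M+1}| ≤ R`, then for every anchor
  `i` with `M + 1 ≤ i`, `i + m + M + 1 < N`, the finite chain embedded with site `i` at the origin gives `A`
  probability within `ε + μ_N{R < |q_{i-M-1}|} + μ_N{R < |q_{i+m+M+1}|}` of `L`.

No definitions, no named facts.
-/

noncomputable section

open MeasureTheory Set Function Finset Literature.Probability.LatticeModels
open scoped ENNReal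

namespace Summit.AtomisticToContinuum.FouriersLaw.Theorems.AbelThermodynamicLimit.SeriesLawAtEveryLaplaceFrequency

open Literature.MathematicalPhysics.KineticTheory.HeatConduction OscillatorChain

namespace BulkWindow

/-- The embedding of the finite chain at an enumerated site reads the finite coordinates. -/
theorem embed_Icc_apply {N : ℕ} {s : ℤ} (e : Fin N ≃ ↥(Finset.Icc s (s + N - 1)))
    (he : ∀ k : Fin N, ((e k : ↥(Finset.Icc s (s + N - 1))) : ℤ) = s + k) (η₀ : ChainConfig)
    (z : PhaseSpace N) (x : ℤ) (k : Fin N) (hk : s + k = x) :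
    embed (Finset.Icc s (s + N - 1)) e η₀ z x = (z.1 k, z.2 k) := by
  have hx : x ∈ Finset.Icc s (s + N - 1) := by rw [← hk, ← he k]; exact (e k).2
  rw [embed_apply_of_mem η₀ z hx]
  have hk' : e.symm ⟨x, hx⟩ = k := by
    rw [Equiv.symm_apply_eq]
    exact Subtype.ext (by rw [he k]; exact hk.symm)
  rw [hk']

/-- **The Hamiltonian of the free finite chain through the embedding**: with `Q x = (ι z x)`,
`H_N(z) = ∑_{x ∈ \{s,…,s+N-1\}} (P_x²/2 + U(Q_x)) + ∑_{y ∈ \{s,…,s+N-2\}} V(Q_{y+1} - Q_y)`. -/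
theorem hamiltonian_eq_sum_embed (P : OscillatorChain) {N : ℕ} {s : ℤ}
    (e : Fin N ≃ ↥(Finset.Icc s (s + N - 1)))
    (he : ∀ k : Fin N, ((e k : ↥(Finset.Icc s (s + N - 1))) : ℤ) = s + k) (η₀ : ChainConfig)
    (z : PhaseSpace N) :
    P.hamiltonian N z =
      (∑ x ∈ Finset.Icc s (s + N - 1),
        ((embed (Finset.Icc s (s + N - 1)) e η₀ z x).2 ^ 2 / 2 +
          P.U (embed (Finset.Icc s (s + N - 1)) e η₀ z x).1)) +
      ∑ y ∈ Finset.Icc s (s + N - 2),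
        P.V ((embed (Finset.Icc s (s + N - 1)) e η₀ z (y + 1)).1 -
          (embed (Finset.Icc s (s + N - 1)) e η₀ z y).1) := by
  set ι := embed (Finset.Icc s (s + N - 1)) e η₀ with hι
  have hιk : ∀ k : Fin N, ι z (s + k) = (z.1 k, z.2 k) := fun k => embed_Icc_apply e he η₀ z _ k rfl
  unfold OscillatorChain.hamiltonian
  congr 1
  · -- sites
    rw [← Finset.sum_coe_sort (Finset.Icc s (s + N - 1)), ← e.sum_comp]
    refine Finset.sum_congr rfl fun k _ => ?_
    rw [he k, hιk k]
  · -- bonds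
    have hin : ∀ i : Fin N, (∑ j : Fin N, if j.val = i.val + 1 then P.V (z.1 j - z.1 i) else 0) =
        if i.val + 1 < N then P.V ((ι z (s + i + 1)).1 - (ι z (s + i)).1) else 0 := by
      intro i
      by_cases h : i.val + 1 < N
      · rw [if_pos h, Finset.sum_eq_single ⟨i.val + 1, h⟩]
        · rw [if_pos rfl, hιk i]
          have e1 : s + ↑↑i + 1 = s + ↑↑(⟨i.val + 1, h⟩ : Fin N) := by push_cast; ring
          rw [e1, hιk]
        · intro j _ hj
          rw [if_neg]
          intro hv
          exact hj (Fin.ext hv)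
        · intro h'
          exact absurd (Finset.mem_univ _) h'
      · rw [if_neg h]
        refine Finset.sum_eq_zero fun j _ => ?_
        rw [if_neg]
        intro hv
        exact h (hv ▸ j.isLt)
    -- adapted from `LightConeBondHeat.sum_sum_bond_eq` (…LightConeBondHeatVirialAlgebra): collapse the partner sum
    simp_rw [hin]
    rw [← Finset.sum_filter]
    refine Finset.sum_nbij (fun i : Fin N => s + i.val) ?_ ?_ ?_ ?_
    · intro i hi
      simp only [Finset.mem_filter, Finset.mem_univ, true_and] at hi
      simp only [Finset.mem_Icc]
      omega
    · intro i _ j _ hij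
      exact Fin.ext (by simpa using hij)
    · intro y hy
      simp only [Finset.coe_Icc, Set.mem_Icc] at hy
      refine ⟨⟨(y - s).toNat, by omega⟩, ?_, ?_⟩
      · simp only [Finset.coe_filter, Finset.mem_univ, true_and, Set.mem_setOf_eq]
        omega
      · simp only
        omega
    · intro i _
      simp only [add_assoc]


/-- `e^{-(∑f + ∑g)/T}` as a product of `ℝ≥0∞`-valued site and bond factors. -/
theorem ofReal_exp_neg_sum_add_sum_div (T : ℝ) (S₁ S₂ : Finset ℤ) (f g : ℤ → ℝ) :
    ENNReal.ofReal (Real.exp (-(∑ x ∈ S₁, f x + ∑ y ∈ S₂, g y) / T)) =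
      (∏ x ∈ S₁, ENNReal.ofReal (Real.exp (-T⁻¹ * f x))) *
        ∏ y ∈ S₂, ENNReal.ofReal (Real.exp (-T⁻¹ * g y)) := by
  rw [show -(∑ x ∈ S₁, f x + ∑ y ∈ S₂, g y) / T = -T⁻¹ * ∑ x ∈ S₁, f x + -T⁻¹ * ∑ y ∈ S₂, g y by ring,
    Real.exp_add, Finset.mul_sum, Finset.mul_sum, Real.exp_sum, Real.exp_sum,
    ENNReal.ofReal_mul (Finset.prod_nonneg fun _ _ => (Real.exp_pos _).le),
    ENNReal.ofReal_prod_of_nonneg fun _ _ => (Real.exp_pos _).le,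
    ENNReal.ofReal_prod_of_nonneg fun _ _ => (Real.exp_pos _).le]

/-- **The free-boundary finite-volume Gibbs state is a DLR state in the bulk.** Let `U`, `V` be
measurable, `T > 0`, `V ≥ 0`, `e^{-U/T} ∈ L¹` (so that the normalisers `Z_Λ(η)` are finite and
positive) and `e^{-H_N/T}` integrable. Embed the phase space of the free `N`-chain into `ℤ → ℝ × ℝ`
along the sites `{s, …, s+N-1}` (`η₀` elsewhere). Then for every finite `Λ` whose bonds are interior
bonds of the chain (`bondSet Λ ⊆ {s, …, s+N-2}`) and every measurable `A`,
`μ_{N,T}(ι⁻¹ A) = ∫ γ_Λ(A | ι z) dμ_{N,T}(z)` with the specification kernel `γ_Λ = chainSpecification P T Λ`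
of the infinite chain: the nearest-neighbour Boltzmann weight factorises as `e^{-H_Λ/T} · R` with `R`
not reading `Λ` (Georgii 2011, Thm 10.25/§11.1 step; Friedli–Velenik 2017, Lemma 6.15). -/
theorem gibbsMeasure_preimage_embed_eq_lintegral_chainSpecification (P : OscillatorChain)
    (hU : Measurable P.U) (hV : Measurable P.V) {T : ℝ} (hT : 0 < T) (hV0 : ∀ r, 0 ≤ P.V r)
    (hUi : Integrable (fun q : ℝ => Real.exp (-T⁻¹ * P.U q))) {N : ℕ}
    (hint : Integrable (P.gibbsDensity N T)) {s : ℤ} (e : Fin N ≃ ↥(Finset.Icc s (s + N - 1)))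
    (he : ∀ k : Fin N, ((e k : ↥(Finset.Icc s (s + N - 1))) : ℤ) = s + k) (η₀ : ChainConfig)
    {Λ : Finset ℤ} (hΛ : bondSet Λ ⊆ Finset.Icc s (s + N - 2)) {A : Set ChainConfig}
    (hA : MeasurableSet A) :
    P.gibbsMeasure N T ((embed (Finset.Icc s (s + N - 1)) e η₀) ⁻¹' A) =
      ∫⁻ z, P.chainSpecification T Λ (embed (Finset.Icc s (s + N - 1)) e η₀ z) A
        ∂(P.gibbsMeasure N T) := by
  classical
  have hιm : Measurable (embed (Finset.Icc s (s + N - 1)) e η₀) := measurable_embed η₀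
  -- weights
  set w : ℝ × ℝ → ℝ≥0∞ := fun u => ENNReal.ofReal (Real.exp (-T⁻¹ * (u.2 ^ 2 / 2 + P.U u.1))) with hw
  set kk : ℝ × ℝ → ℝ × ℝ → ℝ≥0∞ := fun u v =>
    ENNReal.ofReal (Real.exp (-T⁻¹ * P.V (v.1 - u.1))) with hkk
  set BΛ : ChainConfig → ℝ≥0∞ := fun σ =>
    ENNReal.ofReal (Real.exp (-T⁻¹ * hamiltonianIn P.chainPotential chainSupp Λ σ)) with hBΛ
  set R : ChainConfig → ℝ≥0∞ := fun σ => (∏ x ∈ Finset.Icc s (s + N - 1) \ Λ, w (σ x)) *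
    ∏ y ∈ Finset.Icc s (s + N - 2) \ bondSet Λ, kk (σ y) (σ (y + 1)) with hR
  set Bf : ChainConfig → ℝ≥0∞ := fun σ => (∏ x ∈ Finset.Icc s (s + N - 1), w (σ x)) *
    ∏ y ∈ Finset.Icc s (s + N - 2), kk (σ y) (σ (y + 1)) with hBf
  have hwm : Measurable w := by simp only [hw]; fun_prop
  have hkkm : Measurable (uncurry kk) := by
    simp only [hkk]
    show Measurable fun p : (ℝ × ℝ) × (ℝ × ℝ) =>
      ENNReal.ofReal (Real.exp (-T⁻¹ * P.V (p.2.1 - p.1.1)))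
    fun_prop
  have hBΛm : Measurable BΛ := P.measurable_boltzmannWeight hU hV T Λ
  have hBfm : Measurable Bf := by
    simp only [hBf]
    exact (Finset.measurable_prod _ fun x _ => measurable_comp_eval hwm x).mul
      (Finset.measurable_prod _ fun y _ => measurable_kernel_eval hkkm y (y + 1))
  have hqm : Measurable fun η => P.chainSpecification T Λ η A :=
    P.measurable_chainSpecification_apply hU hV T Λ hA
  have hindm : Measurable (A.indicator (1 : ChainConfig → ℝ≥0∞)) := measurable_one.indicator hA
  have hΛsub : Λ ⊆ Finset.Icc s (s + N - 1) := fun x hx => by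
    have := Finset.mem_Icc.1 (hΛ (subset_bondSet Λ hx))
    simp only [Finset.mem_Icc]
    omega
  -- F1: the free weight splits as the `Λ`-Boltzmann weight times a `Λ`-independent rest
  have hF1 : ∀ σ, Bf σ = BΛ σ * R σ := fun σ => by
    simp only [hBf, hBΛ, hR, hw, hkk]
    rw [P.ofReal_exp_neg_hamiltonianIn T Λ σ, ← Finset.prod_sdiff hΛsub, ← Finset.prod_sdiff hΛ]
    ring
  have hRdep : DependsOn R ((↑Λ : Set ℤ)ᶜ) := by
    intro σ σ' h
    have h' : ∀ i, i ∉ Λ → σ i = σ' i := fun i hi => h i (by simpa using hi)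
    simp only [hR]
    congr 1
    · exact Finset.prod_congr rfl fun x hx => by rw [h' x (Finset.mem_sdiff.1 hx).2]
    · refine Finset.prod_congr rfl fun y hy => ?_
      have hy' := (Finset.mem_sdiff.1 hy).2
      rw [mem_bondSet_iff, not_or] at hy'
      rw [h' y hy'.1, h' (y + 1) hy'.2]
  have hqdep : DependsOn (fun η => P.chainSpecification T Λ η A) ((↑Λ : Set ℤ)ᶜ) :=
    P.dependsOn_chainSpecification_apply hU hV T Λ hA
  -- F2: the Gibbs density through the embedding
  have hF2 : ∀ z, ENNReal.ofReal (P.gibbsDensity N T z) =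
      Bf (embed (Finset.Icc s (s + N - 1)) e η₀ z) := by
    intro z
    rw [OscillatorChain.gibbsDensity, hamiltonian_eq_sum_embed P e he η₀ z,
      ofReal_exp_neg_sum_add_sum_div]
  -- F3: Lebesgue integrals through the embedding are marginal integrals
  have hF3 : ∀ G : ChainConfig → ℝ≥0∞, Measurable G →
      ∫⁻ z, G (embed (Finset.Icc s (s + N - 1)) e η₀ z) =
        (∫⋯∫⁻_Finset.Icc s (s + N - 1), G ∂fun _ : ℤ => (volume : Measure (ℝ × ℝ))) η₀ := by
    intro G hG
    rw [← lintegral_map hG hιm, ← map_glueWith_eq_map_embed e η₀,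
      lintegral_map_glueWith_pi_eq_lmarginal _ η₀ hG]
  -- the fibre identity on `Λ`
  have hfib : (∫⋯∫⁻_Λ, (fun σ => BΛ σ * R σ * P.chainSpecification T Λ σ A)
        ∂fun _ : ℤ => (volume : Measure (ℝ × ℝ))) =
      ∫⋯∫⁻_Λ, (fun σ => BΛ σ * R σ * A.indicator 1 σ) ∂fun _ : ℤ => (volume : Measure (ℝ × ℝ)) := by
    refine lmarginal_mul_mul_eq_of_dependsOn _ Λ hBΛm hindm hRdep hqdep fun ρ => ?_
    simp only [hBΛ]
    rw [P.chainSpecification_apply_eq_lmarginal_div hU hV T Λ ρ hA,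
      ENNReal.mul_div_cancel (P.lmarginal_boltzmann_pos hU hV T Λ ρ).ne'
        (P.lmarginal_boltzmann_lt_top hT hV0 hUi Λ ρ).ne]
    exact congrFun (congrArg _ (funext fun τ => mul_comm _ _)) ρ
  -- both sides through the un-normalised Lebesgue integrals
  have hρm : Measurable fun z => ENNReal.ofReal (P.gibbsDensity N T z) := by
    rw [show (fun z => ENNReal.ofReal (P.gibbsDensity N T z)) =
        fun z => Bf (embed (Finset.Icc s (s + N - 1)) e η₀ z) from funext hF2]
    exact hBfm.comp hιm
  have hqιm : Measurable fun z => P.chainSpecification T Λ (embed (Finset.Icc s (s + N - 1)) e η₀ z) A :=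
    hqm.comp hιm
  have h1 : (fun z => ((embed (Finset.Icc s (s + N - 1)) e η₀) ⁻¹' A).indicator
      (fun z => ENNReal.ofReal (P.gibbsDensity N T z)) z) =
      fun z => A.indicator 1 (embed (Finset.Icc s (s + N - 1)) e η₀ z) *
        Bf (embed (Finset.Icc s (s + N - 1)) e η₀ z) := by
    funext z
    simp only [Set.indicator, Set.mem_preimage]
    split_ifs with h
    · rw [Pi.one_apply, one_mul, hF2]
    · rw [zero_mul]
  have h2 : ((fun z => ENNReal.ofReal (P.gibbsDensity N T z)) * fun z =>
      P.chainSpecification T Λ (embed (Finset.Icc s (s + N - 1)) e η₀ z) A) =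
      fun z => P.chainSpecification T Λ (embed (Finset.Icc s (s + N - 1)) e η₀ z) A *
        Bf (embed (Finset.Icc s (s + N - 1)) e η₀ z) := by
    funext z
    simp only [Pi.mul_apply]
    rw [hF2, mul_comm]
  have hm1 : Measurable fun σ => A.indicator 1 σ * Bf σ := hindm.mul hBfm
  have hm2 : Measurable fun σ => P.chainSpecification T Λ σ A * Bf σ := hqm.mul hBfm
  have hunion : Finset.Icc s (s + N - 1) = (Finset.Icc s (s + N - 1) \ Λ) ∪ Λ :=
    (Finset.sdiff_union_of_subset hΛsub).symm
  have hdisj : Disjoint (Finset.Icc s (s + N - 1) \ Λ) Λ := Finset.sdiff_disjoint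
  have e1 : (fun σ => A.indicator 1 σ * Bf σ) = fun σ => BΛ σ * R σ * A.indicator 1 σ :=
    funext fun σ => by rw [hF1]; ring
  have e2 : (fun σ => P.chainSpecification T Λ σ A * Bf σ) =
      fun σ => BΛ σ * R σ * P.chainSpecification T Λ σ A := funext fun σ => by rw [hF1]; ring
  rw [P.gibbsMeasure_eq_smul_withDensity hint, Measure.smul_apply, lintegral_smul_measure,
    withDensity_apply _ (hA.preimage hιm), ← lintegral_indicator (hA.preimage hιm),
    lintegral_withDensity_eq_lintegral_mul _ hρm hqιm, h1, h2]
  beta_reduce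
  rw [hF3 _ hm1, hF3 _ hm2]
  congr 1
  conv_lhs => rw [hunion, lmarginal_union _ _ hm1 hdisj, e1]
  conv_rhs => rw [hunion, lmarginal_union _ _ hm2 hdisj, e2]
  rw [hfib]


/-! ### The window-event estimate for the pinned chain -/

section Pinned

variable {ω₂ lam β : ℝ}

/-- **Finite-volume window probabilities are boundary-limit values up to boundary tails.** For the
pinned chain, `T > 0`, a window event `A` and a margin `M` on which the specification kernel
`γ_{\{-M,…,m+M\}}(A | η)` is `ε`-close to `L` whenever `|q_{-M-1}|, |q_{m+M+1}| ≤ R`: for every anchor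
`i` with `M + 1 ≤ i` and `i + m + M + 1 < N`, the free finite chain embedded with site `i` at the
origin gives `A` probability within `ε + μ_N{R < |q_{i-M-1}|} + μ_N{R < |q_{i+m+M+1}|}` of `L`. -/
theorem pinnedChain_abs_gibbsMeasure_preimage_embed_sub_le (γ : ℝ) (hω : 0 < ω₂) (hl : 0 ≤ lam)
    (hβ : 0 ≤ β) {T : ℝ} (hT : 0 < T) (m : ℕ) {A : Set ChainConfig} (hA : MeasurableSet A)
    {L R ε : ℝ} (hL0 : 0 ≤ L) (hL1 : L ≤ 1) (hε : 0 ≤ ε) {M : ℕ}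
    (hM : ∀ η : ChainConfig, |(η ((0 : ℤ) - M - 1)).1| ≤ R → |(η ((0 : ℤ) + m + M + 1)).1| ≤ R →
      |(((pinnedChain ω₂ lam β γ).chainSpecification T (Finset.Icc ((0 : ℤ) - M) ((0 : ℤ) + m + M)) η)
        A).toReal - L| < ε)
    {N : ℕ} (i : Fin N) (hL : M + 1 ≤ i.val) (hi : i.val + m + M + 1 < N)
    (e : Fin N ≃ ↥(Finset.Icc (-(i.val : ℤ)) (-(i.val : ℤ) + N - 1)))
    (he : ∀ k : Fin N, ((e k : ↥(Finset.Icc (-(i.val : ℤ)) (-(i.val : ℤ) + N - 1))) : ℤ) = -(i.val : ℤ) + k)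
    (η₀ : ChainConfig) :
    |((pinnedChain ω₂ lam β γ).gibbsMeasure N T
        ((embed (Finset.Icc (-(i.val : ℤ)) (-(i.val : ℤ) + N - 1)) e η₀) ⁻¹' A)).toReal - L| ≤
      ε + ((pinnedChain ω₂ lam β γ).gibbsMeasure N T).real {z | R < |z.1 ⟨i.val - M - 1, by omega⟩|} +
        ((pinnedChain ω₂ lam β γ).gibbsMeasure N T).real {z | R < |z.1 ⟨i.val + m + M + 1, by omega⟩|} := by
  set P := pinnedChain ω₂ lam β γ with hP
  set μ := P.gibbsMeasure N T with hμ
  haveI : IsProbabilityMeasure μ := pinnedChain_isProbabilityMeasure_gibbsMeasure hω hl hβ γ N hT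
  have hUc : Continuous P.U := (pinnedChain_contDiff_U ω₂ lam β γ (n := 0)).continuous
  have hVc : Continuous P.V := (pinnedChain_contDiff_V ω₂ lam β γ (n := 0)).continuous
  have hV0 : ∀ r, 0 ≤ P.V r := fun r => by show 0 ≤ r ^ 2 / 2 + β * r ^ 4 / 4; positivity
  set Λ : Finset ℤ := Finset.Icc ((0 : ℤ) - M) ((0 : ℤ) + m + M) with hΛ
  have hΛb : bondSet Λ ⊆ Finset.Icc (-(i.val : ℤ)) (-(i.val : ℤ) + N - 2) := fun y hy => by
    rcases mem_bondSet_iff.1 hy with h | h <;>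
    · simp only [hΛ, Finset.mem_Icc] at h ⊢; omega
  set ι := embed (Finset.Icc (-(i.val : ℤ)) (-(i.val : ℤ) + N - 1)) e η₀ with hι
  have hιm : Measurable ι := measurable_embed η₀
  -- DLR through the embedding
  have hDLR : μ (ι ⁻¹' A) = ∫⁻ z, P.chainSpecification T Λ (ι z) A ∂μ :=
    gibbsMeasure_preimage_embed_eq_lintegral_chainSpecification P hUc.measurable hVc.measurable hT hV0
      (integrable_exp_neg_pinning hT hω hl β γ) (pinnedChain_integrable_gibbsDensity hω hl hβ γ N hT)
      e he η₀ hΛb hA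
  -- the integrand as a real function in `[0, 1]`
  set g : PhaseSpace N → ℝ := fun z => (P.chainSpecification T Λ (ι z) A).toReal with hg
  have hfm : Measurable fun z => P.chainSpecification T Λ (ι z) A :=
    (P.measurable_chainSpecification_apply hUc.measurable hVc.measurable T Λ hA).comp hιm
  have hf1 : ∀ z, P.chainSpecification T Λ (ι z) A ≤ 1 := fun z => by
    haveI := condB2_pinnedChain γ hω hl hβ hT Λ (ι z)
    exact prob_le_one
  have hgm : Measurable g := ENNReal.measurable_toReal.comp hfm
  have hg0 : ∀ z, 0 ≤ g z := fun z => ENNReal.toReal_nonneg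
  have hg1 : ∀ z, g z ≤ 1 := fun z =>
    ENNReal.toReal_le_of_le_ofReal zero_le_one (by rw [ENNReal.ofReal_one]; exact hf1 z)
  have hgi : Integrable g μ := (integrable_const (1 : ℝ)).mono' hgm.aestronglyMeasurable
    (Filter.Eventually.of_forall fun z => by rw [Real.norm_eq_abs, abs_of_nonneg (hg0 z)]; exact hg1 z)
  have hreal : (μ (ι ⁻¹' A)).toReal = ∫ z, g z ∂μ := by
    rw [hDLR, hg, integral_toReal hfm.aemeasurable
      (Filter.Eventually.of_forall fun z => (hf1 z).trans_lt ENNReal.one_lt_top)]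
  -- the boundary sites through the embedding
  have hleft : ∀ z : PhaseSpace N, (ι z ((0 : ℤ) - M - 1)).1 = z.1 ⟨i.val - M - 1, by omega⟩ := fun z => by
    rw [hι, embed_Icc_apply e he η₀ z _ ⟨i.val - M - 1, by omega⟩ (by push_cast; omega)]
  have hright : ∀ z : PhaseSpace N, (ι z ((0 : ℤ) + m + M + 1)).1 = z.1 ⟨i.val + m + M + 1, by omega⟩ :=
    fun z => by
      rw [hι, embed_Icc_apply e he η₀ z _ ⟨i.val + m + M + 1, by omega⟩ (by push_cast; omega)]
  -- the bad set and the pointwise bound (adapted from `OscillatorChain.measureReal_eq_of_isChainGibbsMeasure_of_tight`)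
  set bad : Set (PhaseSpace N) := {z | R < |z.1 ⟨i.val - M - 1, by omega⟩|} ∪
    {z | R < |z.1 ⟨i.val + m + M + 1, by omega⟩|} with hbad
  have hmeas : ∀ j : Fin N, MeasurableSet {z : PhaseSpace N | R < |z.1 j|} := fun j =>
    measurableSet_lt measurable_const
      (continuous_abs.measurable.comp ((measurable_pi_apply j).comp measurable_fst))
  have hbadm : MeasurableSet bad := (hmeas _).union (hmeas _)
  have hpt : ∀ z, |g z - L| ≤ ε + bad.indicator (1 : PhaseSpace N → ℝ) z := by
    intro z
    by_cases hz : z ∈ bad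
    · rw [Set.indicator_of_mem hz, Pi.one_apply]
      have h2 : |g z - L| ≤ 1 := abs_sub_le_iff.2 ⟨by linarith [hg1 z], by linarith [hg0 z]⟩
      linarith
    · rw [Set.indicator_of_notMem hz, add_zero]
      have hz' : |z.1 ⟨i.val - M - 1, by omega⟩| ≤ R ∧ |z.1 ⟨i.val + m + M + 1, by omega⟩| ≤ R := by
        simpa only [hbad, Set.mem_union, Set.mem_setOf_eq, not_or, not_lt] using hz
      have := hM (ι z) (by rw [hleft]; exact hz'.1) (by rw [hright]; exact hz'.2)
      exact this.le
  have hind : Integrable (bad.indicator (1 : PhaseSpace N → ℝ)) μ :=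
    (integrable_const (1 : ℝ)).indicator hbadm
  have hbi : Integrable (fun z => ε + bad.indicator (1 : PhaseSpace N → ℝ) z) μ :=
    (integrable_const ε).add hind
  rw [hreal]
  calc |∫ z, g z ∂μ - L| = |∫ z, (g z - L) ∂μ| := by
        rw [integral_sub hgi (integrable_const L), integral_const, smul_eq_mul, probReal_univ, one_mul]
    _ ≤ ∫ z, |g z - L| ∂μ := abs_integral_le_integral_abs
    _ ≤ ∫ z, (ε + bad.indicator (1 : PhaseSpace N → ℝ) z) ∂μ :=
        integral_mono (hgi.sub (integrable_const L)).abs hbi hpt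
    _ = ε + μ.real bad := by
        rw [integral_add (integrable_const ε) hind, integral_const, smul_eq_mul, probReal_univ,
          one_mul, integral_indicator_one hbadm]
    _ ≤ ε + (μ.real {z | R < |z.1 ⟨i.val - M - 1, by omega⟩|} +
          μ.real {z | R < |z.1 ⟨i.val + m + M + 1, by omega⟩|}) := by
        gcongr
        exact measureReal_union_le _ _
    _ = _ := by ring

end Pinned

end BulkWindow

/-- **Registered helper `pinnedChain_windowEventDLREstimate` — finite-volume window probabilities are boundary-limit
values up to boundary tails.** For the pinned chain (`ω₂ > 0`, `lam, β ≥ 0`), `T > 0`, a window event `A` and a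
margin `M` on which the specification kernel `γ_{\{-M,…,m+M\}}(A | η)` is `ε`-close to `L ∈ [0, 1]` whenever
`|q_{-M-1}|, |q_{m+M+1}| ≤ R`: for every anchor `i` with `M + 1 ≤ i`, `i + m + M + 1 < N` and every enumeration
`k ↦ -i + k` of the chain sites, the free finite-volume Gibbs state gives the pulled-back event probability within
`ε + μ_N{R < |q_{i-M-1}|} + μ_N{R < |q_{i+m+M+1}|}` of `L` (DLR in the bulk + the pointwise kernel estimate). -/
theorem pinnedChain_windowEventDLREstimate :
    ∀ ω₂ lam β γ : ℝ, 0 < ω₂ → 0 ≤ lam → 0 ≤ β → ∀ T : ℝ, 0 < T →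
      ∀ (m : ℕ) (A : Set Literature.MathematicalPhysics.KineticTheory.HeatConduction.ChainConfig), MeasurableSet A →
      ∀ (L R ε : ℝ), 0 ≤ L → L ≤ 1 → 0 ≤ ε → ∀ M : ℕ,
        (∀ η : Literature.MathematicalPhysics.KineticTheory.HeatConduction.ChainConfig,
          |(η ((0 : ℤ) - M - 1)).1| ≤ R → |(η ((0 : ℤ) + m + M + 1)).1| ≤ R →
          |(((Literature.MathematicalPhysics.KineticTheory.HeatConduction.pinnedChain ω₂ lam β γ).chainSpecification T
              (Finset.Icc ((0 : ℤ) - M) ((0 : ℤ) + m + M)) η) A).toReal - L| < ε) →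
        ∀ (N : ℕ) (i : Fin N) (hL : M + 1 ≤ i.val) (hi : i.val + m + M + 1 < N)
          (e : Fin N ≃ ↥(Finset.Icc (-(i.val : ℤ)) (-(i.val : ℤ) + N - 1))),
          (∀ k : Fin N, ((e k : ↥(Finset.Icc (-(i.val : ℤ)) (-(i.val : ℤ) + N - 1))) : ℤ) = -(i.val : ℤ) + k) →
          ∀ η₀ : Literature.MathematicalPhysics.KineticTheory.HeatConduction.ChainConfig,
            |((Literature.MathematicalPhysics.KineticTheory.HeatConduction.pinnedChain ω₂ lam β γ).gibbsMeasure N T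
                ((Literature.MathematicalPhysics.KineticTheory.HeatConduction.OscillatorChain.embed
                  (Finset.Icc (-(i.val : ℤ)) (-(i.val : ℤ) + N - 1)) e η₀) ⁻¹' A)).toReal - L| ≤
              ε + ((Literature.MathematicalPhysics.KineticTheory.HeatConduction.pinnedChain ω₂ lam β γ).gibbsMeasure N T).real
                    {z | R < |z.1 ⟨i.val - M - 1, by omega⟩|} +
                ((Literature.MathematicalPhysics.KineticTheory.HeatConduction.pinnedChain ω₂ lam β γ).gibbsMeasure N T).real
                    {z | R < |z.1 ⟨i.val + m + M + 1, by omega⟩|} :=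
  fun _ω₂ _lam _β γ hω hl hβ _T hT m _A hA _L _R _ε hL0 hL1 hε _M hM _N i hL hi e he η₀ =>
    BulkWindow.pinnedChain_abs_gibbsMeasure_preimage_embed_sub_le γ hω hl hβ hT m hA hL0 hL1 hε hM i hL hi e he η₀

end Summit.AtomisticToContinuum.FouriersLaw.Theorems.AbelThermodynamicLimit.SeriesLawAtEveryLaplaceFrequency

end
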